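import Literature.NumberTheory.LFunctions.FordIncompleteLemma42
import Literature.NumberTheory.LFunctions.FordIncompleteLemma43
import Literature.NumberTheory.LFunctions.FordIncompleteBasics
import Literature.NumberTheory.LFunctions.FordRoughSmoothBridge
import HarnessLib

/-!
# Ford's Theorem 4 (Vinogradov's integral for incomplete systems), library constants

Topic `Literature/NumberTheory/LFunctions`. Everything here is PROVED.

K. Ford, Proc. LMS 85 (2002), **Theorem 4**: for `k ≥ 60`, `0.9k ≤ h ≤ k − 2`, `t = k − h + 1`,
`2t ≤ s ≤ ⌊h/2⌋ t`, `P ≥ e^{Dk²}` (`D ≥ 10`) and (1.10)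
(`2/k³ < η ≤ 1/(2k)`, `18/k ≤ 4 log k/(Dk²η) ≤ 0.4`),
`J_{s,k,h}(𝒞(P,P^η)) ≤ e^C P^{2s − (t/2)(h+k) + t(t−1)/2 + ηs²/(2t) + ht e^{−s/(ht)}}`,
`C = s²/t + 10.5 t log²k/(Dkη²) − s((1/η + h)(1 − 1/h)^{s/t} − h) log(1/(10η))`.

This file proves the theorem with the inputs available in the tree — Lemma 4.1/4.2 with the
library's constants (`FordVK.ford_lemma42`: `12η` for `10η`, `C₁ = (tk)^t`), Lemma 4.3
(`FordVK.ford_lemma43'`), and Lemma 2.2 in the form `FordVK.card_calC_ge` (which needs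
`log R ≥ 80`) for (4.11) — i.e. **Theorem 4 with `log(1/(12η))` in place of `log(1/(10η))` and the
extra hypothesis `η log P ≥ 80`** (`FordVK.ford_theorem4_lib`); the constant `10.5` and the exponent
of `P` are Ford's. (The printed `s ≤ ⌊h/2⌋t` is kept with the integer part, as in the source.)

Proof = Ford's (pp. 13–14): Lemma 4.2 at `L = ⌊s/t⌋` and `L + 1`, Hölder
`J_s ≤ J_{Lt}^{1−u/t} J_{(L+1)t}^{u/t}` (`s = Lt + u`; `FordVK.integral_rpow_interpolate_le`), the
bound `max_j E_j ≤ 10.5 log²k/(Dkη²)` (Lemma 4.3 with `x ∈ [18/k, 0.408]`), and the estimates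
`(1−u/t)Δ_L + (u/t)Δ_{L+1} < t(t−1)/2 + ht e^{−s/(ht)}`, `(e²R)^{tL²/2 + L(u−t/2)} < (e²R)^{s²/(2t)}`,
`α^{L−1} > α^L ≥ α^{s/t}`; everything is done in logarithms.

## References

* K. Ford, *Vinogradov's integral and bounds for the Riemann zeta function*, Proc. London Math.
  Soc. (3) 85 (2002), 565–633; arXiv:1910.08209 — Theorem 4 and its proof, (1.10), (4.11),
  (4.19). [Ford2002]
-/

noncomputable section

open Finset MeasureTheory
open scoped Real

namespace Literature.NumberTheory.LFunctions
namespace FordVK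

open VMV FordSmooth

/-! ### (4.11) from Lemma 2.2 (library form) -/

/-- `log ((n+1)!) ≤ (n+1) log (n+1)`. [folklore] -/
theorem log_factorial_succ_le (n : ℕ) : Real.log ((n + 1).factorial : ℝ) ≤ ((n : ℝ) + 1) * Real.log ((n : ℝ) + 1) := by
  have h := Nat.factorial_le_pow (n + 1)
  have h1 : ((n + 1).factorial : ℝ) ≤ (((n : ℝ) + 1)) ^ (n + 1) := by exact_mod_cast h
  have h0 : (0 : ℝ) < (n + 1).factorial := by exact_mod_cast Nat.factorial_pos _
  calc Real.log ((n + 1).factorial : ℝ) ≤ Real.log ((((n : ℝ) + 1)) ^ (n + 1)) := Real.log_le_log h0 h1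
    _ = ((n : ℝ) + 1) * Real.log ((n : ℝ) + 1) := by rw [Real.log_pow]; push_cast; ring

/-- **(4.11) from Lemma 2.2** (`δ = 1/10`): for `log R ≥ 80`, `log R ≥ 10 log k`, `k ≥ 60`, and
`R^{40} ≤ Q ≤ R^{k³}`, `|𝒞(Q,R)| ≥ Q^{1/2}`. [cite: Ford2002, proof of Theorem 4
("|𝒞(Q,R)| ≥ 11^{−w}/((w+1)w!) Q/log R ≥ … = Q^β, β ≥ 0.9; thus (4.11) holds")] -/
theorem card_C_ge_sqrt {R Q k : ℝ} (hk : 60 ≤ k) (hR1 : 1 < R) (hL : 80 ≤ Real.log R)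
    (hLk : 10 * Real.log k ≤ Real.log R) (hQ1 : R ^ (40 : ℝ) ≤ Q) (hQ2 : Q ≤ R ^ (k ^ 3)) :
    Q ^ (1 / 2 : ℝ) ≤ ((smoothSet Q R).card : ℝ) := by
  have hR0 : 0 < R := by linarith
  have hlogR : 0 < Real.log R := by linarith
  set u : ℝ := Real.log Q / Real.log R with hu
  have hQ0 : 0 < Q := lt_of_lt_of_le (Real.rpow_pos_of_pos hR0 _) hQ1
  have hQeq : Q = R ^ u := by
    rw [hu, Real.rpow_def_of_pos hR0, mul_div_cancel₀ _ hlogR.ne', Real.exp_log hQ0]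
  have hu40 : 40 ≤ u := by
    rw [hu, le_div_iff₀ hlogR, ← Real.log_rpow hR0]; exact Real.log_le_log (Real.rpow_pos_of_pos hR0 _) hQ1
  have huk : u ≤ k ^ 3 := by
    rw [hu, div_le_iff₀ hlogR, ← Real.log_rpow hR0]; exact Real.log_le_log hQ0 hQ2
  -- Lemma 2.2 with `δ = 1/10`
  have h22 := card_calC_ge hR1 hL (δ := 1 / 10) (by norm_num) (by norm_num) (by linarith) (u := u) (by linarith)
  rw [calC_eq_smoothSet, ← hQeq] at h22
  refine le_trans ?_ h22
  -- it remains: `Q^{1/2} ≤ (7/80)^w/(w+1)! · Q / log R`, `w = ⌊u/(9/10)⌋`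
  set w : ℕ := ⌊u / (1 - 1 / 10)⌋₊ with hw
  have hwu : (w : ℝ) ≤ 10 * u / 9 := by
    have := Nat.floor_le (show 0 ≤ u / (1 - 1 / 10) by positivity)
    rw [← hw] at this; refine this.trans (le_of_eq ?_); ring
  have hw1 : (w : ℝ) + 1 ≤ 1.2 * u := by
    have : (1 : ℝ) ≤ 0.08 * u := by linarith
    linarith
  have hw0 : (0 : ℝ) < (w : ℝ) + 1 := by positivity
  have hfact : Real.log ((w + 1).factorial : ℝ) ≤ 1.2 * u * Real.log (1.2 * u) := by
    refine (log_factorial_succ_le w).trans ?_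
    have hlog : Real.log ((w : ℝ) + 1) ≤ Real.log (1.2 * u) := Real.log_le_log hw0 hw1
    have hlog0 : 0 ≤ Real.log ((w : ℝ) + 1) := Real.log_nonneg (by linarith)
    calc ((w : ℝ) + 1) * Real.log ((w : ℝ) + 1) ≤ (1.2 * u) * Real.log ((w : ℝ) + 1) := mul_le_mul_of_nonneg_right hw1 hlog0
      _ ≤ (1.2 * u) * Real.log (1.2 * u) := mul_le_mul_of_nonneg_left hlog (by linarith)
  -- `log u ≤ 3 log k`
  have hk0 : 0 < k := by linarith
  have hlogu : Real.log (1.2 * u) ≤ 0.2 + 3 * Real.log k := by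
    have h1 : Real.log (1.2 * u) = Real.log 1.2 + Real.log u := Real.log_mul (by norm_num) (by linarith)
    have h2 : Real.log 1.2 ≤ 0.2 := by
      rw [Real.log_le_iff_le_exp (by norm_num)]; have := Real.add_one_le_exp (0.2 : ℝ); linarith
    have h3 : Real.log u ≤ Real.log (k ^ 3) := Real.log_le_log (by linarith) huk
    rw [Real.log_pow] at h3; push_cast at h3; linarith
  -- `log log R ≤ log R / 40 · …`: use `log y ≤ y - 1`
  have hloglog : Real.log (Real.log R) ≤ Real.log R - 1 := Real.log_le_sub_one_of_pos hlogR
  -- the key inequality in logarithms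
  have hpos78 : (0 : ℝ) < 7 * (1 / 10) / 8 := by norm_num
  have hlog78 : Real.log (7 * (1 / 10) / 8) ≥ -2.45 := by
    rw [show (7 : ℝ) * (1 / 10) / 8 = 7 / 80 by norm_num, ge_iff_le, Real.le_log_iff_exp_le (by norm_num)]
    -- `exp(-2.45) ≤ 7/80` ⟸ `80/7 ≤ exp 2.45`
    rw [Real.exp_neg, inv_le_comm₀ (Real.exp_pos _) (by norm_num)]
    have h1 : Real.exp 2.45 = Real.exp 1 ^ 2 * Real.exp 0.45 := by
      rw [← Real.exp_nat_mul, ← Real.exp_add]; norm_num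
    have h2 := Real.exp_one_gt_d9
    have h3 : (1.56 : ℝ) ≤ Real.exp 0.45 := by
      have h := Real.exp_bound (x := 0.45) (by norm_num) (n := 4) (by norm_num)
      simp only [Finset.sum_range_succ, Finset.sum_range_zero, Nat.factorial] at h
      norm_num at h
      have := (abs_le.1 h).1
      linarith
    have h4 : (2.7182818283 : ℝ) ^ 2 * 1.56 ≤ Real.exp 1 ^ 2 * Real.exp 0.45 :=
      mul_le_mul (pow_le_pow_left₀ (by norm_num) h2.le 2) h3 (by norm_num) (by positivity)
    rw [h1]; nlinarith
  have hfpos : (0 : ℝ) < ((w + 1).factorial : ℝ) := by exact_mod_cast Nat.factorial_pos _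
  -- assemble: show `log(Q^{1/2}) ≤ log(RHS)`
  have hRHSpos : 0 < (7 * (1 / 10) / 8) ^ w / ((w + 1).factorial : ℝ) * Q / Real.log R := by positivity
  rw [← Real.log_le_log_iff (Real.rpow_pos_of_pos hQ0 _) hRHSpos]
  rw [Real.log_rpow hQ0, Real.log_div (by positivity) hlogR.ne', Real.log_mul (by positivity) hQ0.ne',
    Real.log_div (by positivity) hfpos.ne', Real.log_pow]
  have hlogQ : Real.log Q = u * Real.log R := by rw [hu]; field_simp
  rw [hlogQ]
  -- goal: `1/2 · u log R ≤ w log(7/80) − log((w+1)!) + u log R − log log R`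
  have hw0' : (0 : ℝ) ≤ w := Nat.cast_nonneg _
  have a1 : (w : ℝ) * Real.log (7 * (1 / 10) / 8) ≥ (10 * u / 9) * (-2.45) := by
    have hneg : Real.log (7 * (1 / 10) / 8) ≤ 0 := Real.log_nonpos (by norm_num) (by norm_num)
    nlinarith [mul_le_mul_of_nonpos_right hwu hneg]
  have a2 : 1.2 * u * Real.log (1.2 * u) ≤ 1.2 * u * (0.2 + 3 * Real.log k) := mul_le_mul_of_nonneg_left hlogu (by linarith)
  have hlogk : 4 ≤ Real.log k := by
    rw [Real.le_log_iff_exp_le hk0]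
    have e4 : Real.exp 4 = Real.exp 1 ^ 4 := by rw [← Real.exp_nat_mul]; norm_num
    rw [e4]; have := Real.exp_one_lt_d9
    calc Real.exp 1 ^ 4 ≤ (2.7182818286 : ℝ) ^ 4 := pow_le_pow_left₀ (Real.exp_pos 1).le this.le 4
      _ ≤ 60 := by norm_num
      _ ≤ k := hk
  have key : 2.962 + 3.6 * Real.log k + Real.log R / 40 ≤ Real.log R / 2 := by linarith
  have hu0 : 0 ≤ u := by linarith
  have key' := mul_le_mul_of_nonneg_left key hu0
  have hRu : Real.log R ≤ u / 40 * Real.log R := by nlinarith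
  nlinarith [hfact, a1, a2, hloglog, key', hRu]


/-! ### The data of Theorem 4 -/

/-- The data and hypotheses of Theorem 4 (library version: `η log P ≥ 80` added, `s ≤ ⌊h/2⌋t`).
[cite: Ford2002, Theorem 4 and (1.10)] -/
structure T4Ctx where
  /-- Ford's `k` -/
  k : ℕ
  /-- Ford's `h` -/
  h : ℕ
  /-- Ford's `s` -/
  s : ℕ
  /-- Ford's `P` -/
  P : ℝ
  /-- Ford's `η` -/
  η : ℝ
  /-- Ford's `D` -/
  D : ℝ
  hk : 60 ≤ k
  hh : (0.9 : ℝ) * k ≤ h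
  hhk : h + 2 ≤ k
  hs1 : 2 * (k - h + 1) ≤ s
  hs2 : s ≤ (h / 2) * (k - h + 1)
  hD : 10 ≤ D
  hP : Real.exp (D * (k : ℝ) ^ 2) ≤ P
  hη1 : 2 / (k : ℝ) ^ 3 < η
  hη2 : η ≤ 1 / (2 * (k : ℝ))
  h110a : 18 / (k : ℝ) ≤ 4 * Real.log k / (D * (k : ℝ) ^ 2 * η)
  h110b : 4 * Real.log k / (D * (k : ℝ) ^ 2 * η) ≤ 0.4
  hR80 : 80 ≤ η * Real.log P

namespace T4Ctx

variable (c : T4Ctx)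

/-- `t = k − h + 1`. [cite: Ford2002, Theorem 4] -/
def t : ℕ := c.k - c.h + 1
/-- `L = ⌊s/t⌋`. [cite: Ford2002, proof of Theorem 4 ("s = Lt + u")] -/
def L : ℕ := c.s / c.t
/-- `u = s − Lt`. [cite: Ford2002, proof of Theorem 4 ("s = Lt + u")] -/
def u : ℕ := c.s % c.t
/-- `R = P^η`. [cite: Ford2002, Theorem 4] -/
def R : ℝ := c.P ^ c.η
/-- `α = 1 − 1/h`. [cite: Ford2002, Lemma 4.2] -/
def α : ℝ := 1 - 1 / (c.h : ℝ)
/-- `A = Dk²`. [cite: Ford2002, proof of Theorem 4 ("put … A = Dk²")] -/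
def A : ℝ := c.D * (c.k : ℝ) ^ 2
/-- `x = 4 log k/(Aηα)`. [cite: Ford2002, (4.16)] -/
def x : ℝ := 4 * Real.log c.k / (c.A * c.η * c.α)
/-- `10.5 log²k/(Dkη²)`, the bound for `max_j E_j`. [cite: Ford2002, proof of Theorem 4] -/
def Gm : ℝ := 10.5 * Real.log c.k ^ 2 / (c.D * c.k * c.η ^ 2)
/-- `g = (1/η + h)α^{s/t} − h`. [cite: Ford2002, Theorem 4 (the constant `C`)] -/
def g : ℝ := (1 / c.η + c.h) * c.α ^ ((c.s : ℝ) / c.t) - c.h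

/-! #### Sizes -/

/-- Auxiliary step (elementary consequence of the definitions and the standing hypotheses). [folklore] -/
private theorem k_geR : (60 : ℝ) ≤ c.k := by exact_mod_cast c.hk
/-- Auxiliary step (elementary consequence of the definitions and the standing hypotheses). [folklore] -/
private theorem k_pos : (0 : ℝ) < c.k := by linarith [c.k_geR]
/-- Auxiliary step (elementary consequence of the definitions and the standing hypotheses). [folklore] -/
theorem h_geR : (54 : ℝ) ≤ c.h := by have := c.hh; have := c.k_geR; linarith
/-- Auxiliary step (elementary consequence of the definitions and the standing hypotheses). [folklore] -/
theorem h_ge : 54 ≤ c.h := by exact_mod_cast c.h_geR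
/-- Auxiliary step (elementary consequence of the definitions and the standing hypotheses). [folklore] -/
private theorem h_pos : (0 : ℝ) < c.h := by linarith [c.h_geR]
/-- Auxiliary step (elementary consequence of the definitions and the standing hypotheses). [folklore] -/
theorem hkt : c.h + c.t = c.k + 1 := by unfold t; have := c.hhk; omega
/-- Auxiliary step (elementary consequence of the definitions and the standing hypotheses). [folklore] -/
theorem t_ge : 3 ≤ c.t := by unfold t; have := c.hhk; omega
/-- Auxiliary step (elementary consequence of the definitions and the standing hypotheses). [folklore] -/
theorem t_pos : 0 < c.t := by have := c.t_ge; omega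
/-- Auxiliary step (elementary consequence of the definitions and the standing hypotheses). [folklore] -/
theorem tR : (c.t : ℝ) = c.k - c.h + 1 := by
  have := c.hkt; have h : (c.h : ℝ) + c.t = c.k + 1 := by exact_mod_cast this
  linarith
/-- Auxiliary step (elementary consequence of the definitions and the standing hypotheses). [folklore] -/
private theorem t_posR : (0 : ℝ) < c.t := by exact_mod_cast c.t_pos
/-- Auxiliary step (elementary consequence of the definitions and the standing hypotheses). [folklore] -/
theorem six_t_le : 6 * c.t ≤ c.k := by
  have h1 : (6 : ℝ) * c.t ≤ c.k := by rw [c.tR]; have := c.hh; have := c.k_geR; nlinarith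
  exact_mod_cast h1
/-- Auxiliary step (elementary consequence of the definitions and the standing hypotheses). [folklore] -/
theorem h_le_k : (c.h : ℝ) ≤ c.k := by have := c.hhk; exact_mod_cast (show c.h ≤ c.k by omega)
/-- Auxiliary step (elementary consequence of the definitions and the standing hypotheses). [folklore] -/
theorem s_eq : c.s = c.L * c.t + c.u := by unfold L u; rw [mul_comm]; exact (Nat.div_add_mod _ _).symm
/-- Auxiliary step (elementary consequence of the definitions and the standing hypotheses). [folklore] -/
theorem u_lt : c.u < c.t := Nat.mod_lt _ c.t_pos
/-- Auxiliary step (elementary consequence of the definitions and the standing hypotheses). [folklore] -/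
theorem s_ge : 2 * c.t ≤ c.s := by unfold t; exact c.hs1
/-- Auxiliary step (elementary consequence of the definitions and the standing hypotheses). [folklore] -/
theorem s_le : c.s ≤ (c.h / 2) * c.t := by unfold t; exact c.hs2
/-- Auxiliary step (elementary consequence of the definitions and the standing hypotheses). [folklore] -/
theorem L_ge : 2 ≤ c.L := by
  unfold L; exact (Nat.le_div_iff_mul_le c.t_pos).2 c.s_ge
/-- Auxiliary step (elementary consequence of the definitions and the standing hypotheses). [folklore] -/
theorem L_le : c.L ≤ c.h / 2 := by
  unfold L; exact Nat.div_le_of_le_mul (by rw [mul_comm]; exact c.s_le)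
/-- Auxiliary step (elementary consequence of the definitions and the standing hypotheses). [folklore] -/
theorem two_L_le : 2 * c.L ≤ c.h := by have := c.L_le; omega
/-- Auxiliary step (elementary consequence of the definitions and the standing hypotheses). [folklore] -/
theorem two_L1_le (hu : c.u ≠ 0) : 2 * (c.L + 1) ≤ c.h := by
  have h1 : c.L < c.h / 2 := by
    by_contra hge; push Not at hge
    have := c.s_le; rw [c.s_eq] at this
    have : c.h / 2 * c.t ≤ c.L * c.t := Nat.mul_le_mul_right _ hge
    omega
  omega
/-- Auxiliary step (elementary consequence of the definitions and the standing hypotheses). [folklore] -/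
theorem Lt_le_s : c.L * c.t ≤ c.s := by rw [c.s_eq]; omega
/-- Auxiliary step (elementary consequence of the definitions and the standing hypotheses). [folklore] -/
theorem sR : (c.s : ℝ) = c.L * c.t + c.u := by exact_mod_cast c.s_eq
/-- Auxiliary step (elementary consequence of the definitions and the standing hypotheses). [folklore] -/
theorem L_le_sdivt : (c.L : ℝ) ≤ c.s / c.t := by
  rw [le_div_iff₀ c.t_posR]; exact_mod_cast c.Lt_le_s
/-- Auxiliary step (elementary consequence of the definitions and the standing hypotheses). [folklore] -/
theorem η_pos : 0 < c.η := lt_trans (by have := c.k_pos; positivity) c.hη1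
/-- Auxiliary step (elementary consequence of the definitions and the standing hypotheses). [folklore] -/
theorem logk_pos : 0 < Real.log c.k := Real.log_pos (by linarith [c.k_geR])
/-- Auxiliary step (elementary consequence of the definitions and the standing hypotheses). [folklore] -/
theorem D_pos : 0 < c.D := by linarith [c.hD]
/-- Auxiliary step (elementary consequence of the definitions and the standing hypotheses). [folklore] -/
theorem A_pos : 0 < c.A := by unfold A; have := c.D_pos; have := c.k_pos; positivity
/-- Auxiliary step (elementary consequence of the definitions and the standing hypotheses). [folklore] -/
theorem logP_ge : c.A ≤ Real.log c.P := by
  unfold A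
  have hP0 : 0 < c.P := lt_of_lt_of_le (Real.exp_pos _) c.hP
  rw [Real.le_log_iff_exp_le hP0]; exact c.hP
/-- Auxiliary step (elementary consequence of the definitions and the standing hypotheses). [folklore] -/
theorem one_lt_P : 1 < c.P := by
  refine lt_of_lt_of_le ?_ c.hP
  have h1 : (0 : ℝ) < c.D * (c.k : ℝ) ^ 2 := by have := c.D_pos; have := c.k_pos; positivity
  have h2 := Real.add_one_le_exp (c.D * (c.k : ℝ) ^ 2)
  linarith
/-- Auxiliary step (elementary consequence of the definitions and the standing hypotheses). [folklore] -/
private theorem P_pos : 0 < c.P := by linarith [c.one_lt_P]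
/-- Auxiliary step (elementary consequence of the definitions and the standing hypotheses). [folklore] -/
private theorem logP_pos : 0 < Real.log c.P := Real.log_pos c.one_lt_P
/-- Auxiliary step (elementary consequence of the definitions and the standing hypotheses). [folklore] -/
private theorem logR_eq : Real.log c.R = c.η * Real.log c.P := by unfold R; rw [Real.log_rpow c.P_pos]
/-- Auxiliary step (elementary consequence of the definitions and the standing hypotheses). [folklore] -/
theorem logR_ge : 80 ≤ Real.log c.R := by rw [c.logR_eq]; exact c.hR80
/-- Auxiliary step (elementary consequence of the definitions and the standing hypotheses). [folklore] -/
private theorem R_pos : 0 < c.R := by unfold R; exact Real.rpow_pos_of_pos c.P_pos _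
/-- Auxiliary step (elementary consequence of the definitions and the standing hypotheses). [folklore] -/
private theorem one_lt_R : 1 < c.R := by
  have := c.logR_ge; by_contra hle; push Not at hle
  have := Real.log_nonpos c.R_pos.le hle; linarith
/-- `ηDk² ≥ 10 log k` ((1.10)), hence `log R ≥ 10 log k`. [cite: Ford2002, proof of Theorem 4
("R ≥ e^{ηDk²} ≥ k^{10}")] -/
theorem ηA_ge : 10 * Real.log c.k ≤ c.η * c.A := by
  have h := c.h110b
  unfold A
  rw [div_le_iff₀ (by have := c.D_pos; have := c.k_pos; have := c.η_pos; positivity)] at h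
  linarith
/-- Auxiliary step (elementary consequence of the definitions and the standing hypotheses). [folklore] -/
theorem logR_ge_logk : 10 * Real.log c.k ≤ Real.log c.R := by
  rw [c.logR_eq]; exact c.ηA_ge.trans (mul_le_mul_of_nonneg_left c.logP_ge c.η_pos.le)
/-- Auxiliary step (elementary consequence of the definitions and the standing hypotheses). [folklore] -/
private theorem logk_ge : 4 ≤ Real.log c.k := by
  rw [Real.le_log_iff_exp_le c.k_pos]
  have e4 : Real.exp 4 = Real.exp 1 ^ 4 := by rw [← Real.exp_nat_mul]; norm_num
  rw [e4]; have := Real.exp_one_lt_d9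
  calc Real.exp 1 ^ 4 ≤ (2.7182818286 : ℝ) ^ 4 := pow_le_pow_left₀ (Real.exp_pos 1).le this.le 4
    _ ≤ 60 := by norm_num
    _ ≤ c.k := c.k_geR
/-- `(2/η)³ ≤ R`. [cite: Ford2002, proof of Theorem 4 ("R ≥ e^{ηDk²} ≥ k^{10} > (2/η)³")] -/
theorem R_ge_cube : (2 / c.η) ^ 3 ≤ c.R := by
  have h1 : 2 / c.η < (c.k : ℝ) ^ 3 := by
    rw [div_lt_iff₀ c.η_pos]; have := c.hη1; rw [div_lt_iff₀ (by have := c.k_pos; positivity)] at this; linarith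
  have h2 : 0 < 2 / c.η := by have := c.η_pos; positivity
  rw [← Real.log_le_log_iff (by positivity) c.R_pos, Real.log_pow]
  have h3 : Real.log (2 / c.η) ≤ Real.log ((c.k : ℝ) ^ 3) := Real.log_le_log h2 h1.le
  rw [Real.log_pow] at h3
  have := c.logR_ge_logk; push_cast at h3 ⊢; nlinarith [c.logk_pos]
/-- Auxiliary step (elementary consequence of the definitions and the standing hypotheses). [folklore] -/
theorem exp40_le_R : Real.exp 40 ≤ c.R := by
  rw [← Real.log_le_log_iff (Real.exp_pos _) c.R_pos, Real.log_exp]; linarith [c.logR_ge]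
/-- Auxiliary step (elementary consequence of the definitions and the standing hypotheses). [folklore] -/
theorem η_two_k : c.η * (2 * c.k) ≤ 1 := (le_div_iff₀ (by have := c.k_pos; positivity)).1 c.hη2
/-- Auxiliary step (elementary consequence of the definitions and the standing hypotheses). [folklore] -/
theorem three_η_h : 3 * c.η * c.h ≤ 2 := by
  have h1 := c.η_two_k
  have h2 := mul_le_mul_of_nonneg_left c.h_le_k c.η_pos.le
  nlinarith
/-- Auxiliary step (elementary consequence of the definitions and the standing hypotheses). [folklore] -/
theorem α_pos : 0 < c.α := by
  unfold α
  have : 1 / (c.h : ℝ) ≤ 1 / 54 := div_le_div_of_nonneg_left (by norm_num) (by norm_num) c.h_geR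
  linarith
/-- Auxiliary step (elementary consequence of the definitions and the standing hypotheses). [folklore] -/
theorem α_le_one : c.α ≤ 1 := by
  unfold α
  have : 0 < 1 / (c.h : ℝ) := by have := c.h_pos; positivity
  linarith
/-- Auxiliary step (elementary consequence of the definitions and the standing hypotheses). [folklore] -/
theorem α_ge : 53 / 54 ≤ c.α := by
  unfold α
  have : 1 / (c.h : ℝ) ≤ 1 / 54 := div_le_div_of_nonneg_left (by norm_num) (by norm_num) c.h_geR
  linarith
/-- **(4.11)** for the data of Theorem 4. [cite: Ford2002, proof of Theorem 4 ("Thus, (4.11) holds")] -/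
theorem h411 : ∀ Q : ℝ, c.P ^ (1 / 3 : ℝ) ≤ Q → Q ≤ c.P → Q ^ (1 / 2 : ℝ) ≤ ((smoothSet Q c.R).card : ℝ) := by
  intro Q hQ1 hQ2
  refine card_C_ge_sqrt c.k_geR c.one_lt_R c.logR_ge c.logR_ge_logk ?_ ?_
  · -- `R^{40} = P^{40η} ≤ P^{1/3}`
    refine le_trans ?_ hQ1
    unfold R; rw [← Real.rpow_mul c.P_pos.le]
    refine Real.rpow_le_rpow_of_exponent_le c.one_lt_P.le ?_
    have h2k : (1 : ℝ) / (2 * c.k) ≤ 1 / 120 := by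
      rw [div_le_div_iff₀ (by have := c.k_pos; positivity) (by norm_num)]; linarith [c.k_geR]
    have : c.η ≤ 1 / 120 := c.hη2.trans h2k
    linarith
  · -- `P = R^{1/η} ≤ R^{k³}`
    refine hQ2.trans ?_
    unfold R; rw [← Real.rpow_mul c.P_pos.le]
    calc c.P = c.P ^ (1 : ℝ) := (Real.rpow_one _).symm
      _ ≤ c.P ^ (c.η * (c.k : ℝ) ^ 3) := by
          refine Real.rpow_le_rpow_of_exponent_le c.one_lt_P.le ?_
          have := c.hη1; rw [div_lt_iff₀ (by have := c.k_pos; positivity)] at this; linarith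

/-! #### The two instances of Lemma 4.2 -/

/-- The data of Lemma 4.2 at level `L'` (`1 ≤ L'`, `2L' ≤ h`). [cite: Ford2002, proof of Theorem 4
("Let L be an integer, 2 ≤ L ≤ h/2, and put R = P^η")] -/
def ctx (L' : ℕ) (hL1 : 1 ≤ L') (hL2 : 2 * L' ≤ c.h) : L42Ctx where
  k := c.k
  h := c.h
  t := c.t
  L := L'
  P := c.P
  R := c.R
  η := c.η
  hk := c.hk
  hkt := c.hkt
  ht1 := c.t_pos
  ht6 := c.six_t_le
  hL1 := hL1
  hL2 := hL2
  hη := c.η_pos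
  hηh := c.three_η_h
  hP := c.one_lt_P
  hR := rfl
  hR3 := c.R_ge_cube
  hR40 := c.exp40_le_R
  h411 := c.h411

/-! #### Logarithmic form of Lemma 4.2 -/

/-- `J_{tL,k,h}(𝒞(P,R)) ≥ 1`. [folklore] -/
theorem one_le_Jinc (n : ℕ) : (1 : ℝ) ≤ (Jinc c.k n ((smoothSet c.P c.R).map Nat.castEmbedding) c.h c.k : ℝ) := by
  have h1 := card_pow_le_Jinc c.k c.h c.k n ((smoothSet c.P c.R).map Nat.castEmbedding)
  have hcard : 1 ≤ ((smoothSet c.P c.R).map (Nat.castEmbedding : ℕ ↪ ℤ)).card := by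
    rw [card_map]; refine Finset.card_pos.2 ⟨1, ?_⟩
    rw [mem_smoothSet]; refine ⟨le_rfl, by exact_mod_cast c.one_lt_P.le, ?_⟩
    intro p hp; simp at hp
  have : 1 ≤ Jinc c.k n ((smoothSet c.P c.R).map Nat.castEmbedding) c.h c.k :=
    le_trans (Nat.one_le_pow _ _ hcard) h1
  exact_mod_cast this

/-- **Lemma 4.2 in logarithms**: for the context at level `L'`,
`log J_{L't} ≤ tL'((1/η+h)α^{L'−1} − h) log(12η) + log C_{L'} + tC(L',2)(2 + log R) + X_{L'} log P`.
[cite: Ford2002, Lemma 4.2] -/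
theorem logJ_le {L' : ℕ} (hL1 : 1 ≤ L') (hL2 : 2 * L' ≤ c.h) :
    Real.log (Jinc c.k (c.t * L') ((smoothSet c.P c.R).map Nat.castEmbedding) c.h c.k : ℝ)
      ≤ ((c.t * L' : ℝ) * ((1 / c.η + c.h) * c.α ^ (L' - 1) - c.h)) * Real.log (12 * c.η)
        + Real.log ((c.ctx L' hL1 hL2).Cseq L')
        + (c.t * L'.choose 2 : ℕ) * (2 + Real.log c.R)
        + ((c.t : ℝ) * (2 * L' - c.h * (1 - c.α ^ L'))) * Real.log c.P := by
  have h42 : (Jinc c.k (c.t * L') ((smoothSet c.P c.R).map Nat.castEmbedding) c.h c.k : ℝ)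
      ≤ (12 * c.η) ^ ((c.t * L' : ℝ) * ((1 / c.η + c.h) * (1 - 1 / (c.h : ℝ)) ^ (L' - 1) - c.h))
        * (c.ctx L' hL1 hL2).Cseq L' * (Real.exp 2 * c.R) ^ (c.t * L'.choose 2)
        * c.P ^ ((c.t : ℝ) * (2 * L' - c.h * (1 - (1 - 1 / (c.h : ℝ)) ^ L'))) := ford_lemma42 (c.ctx L' hL1 hL2)
  have hJ := c.one_le_Jinc (c.t * L')
  have hK : 0 < (12 * c.η) := by have := c.η_pos; positivity
  have hCs := (c.ctx L' hL1 hL2).Cseq_pos L'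
  have hER : 0 < Real.exp 2 * c.R := mul_pos (Real.exp_pos _) c.R_pos
  -- take logarithms
  have h1 := Real.log_le_log (lt_of_lt_of_le one_pos hJ) h42
  refine h1.trans (le_of_eq ?_)
  rw [Real.log_mul (by positivity) (Real.rpow_pos_of_pos c.P_pos _).ne',
    Real.log_mul (by positivity) (pow_pos hER _).ne',
    Real.log_mul (Real.rpow_pos_of_pos hK _).ne' hCs.ne',
    Real.log_rpow hK, Real.log_pow, Real.log_mul (Real.exp_pos _).ne' c.R_pos.ne', Real.log_exp,
    Real.log_rpow c.P_pos]
  unfold α; push_cast; ring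

/-! #### The bound for the constants `C_j` -/

/-- `x ≥ 18/k`, `x ≤ 0.408`, `4 log k/η = xAα`. [cite: Ford2002, proof of Theorem 4 ("x ∈ [18/k, 0.408]")] -/
theorem x_facts : 18 / (c.k : ℝ) ≤ c.x ∧ c.x ≤ 0.408 ∧ 4 * Real.log c.k / c.η = c.x * c.A * c.α ∧ 0 < c.x := by
  have hα0 := c.α_pos; have hα1 := c.α_le_one; have hαge := c.α_ge
  set y : ℝ := 4 * Real.log c.k / (c.D * (c.k : ℝ) ^ 2 * c.η) with hy
  have hy0 : 0 < y := by have := c.D_pos; have := c.k_pos; have := c.η_pos; have := c.logk_pos; positivity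
  have hxy : c.x = y / c.α := by unfold x A; rw [hy]; field_simp
  have hy1 := c.h110a; have hy2 := c.h110b
  rw [← hy] at hy1 hy2
  refine ⟨?_, ?_, ?_, ?_⟩
  · rw [hxy, le_div_iff₀ hα0]; nlinarith
  · rw [hxy, div_le_iff₀ hα0]; nlinarith
  · rw [hxy]; unfold A; rw [hy]
    have := c.k_pos.ne'; have := c.D_pos.ne'; have := c.η_pos.ne'; have := hα0.ne'
    field_simp
  · rw [hxy]; exact div_pos hy0 hα0

/-- `log(tk) ≤ 10.5 log²k/(Dkη²)` (so `C_1 = (tk)^t ≤ e^{t·Gm}`). [cite: Ford2002, proof of Lemma 4.2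
("Since e^{tE_2} > C_1")] -/
theorem log_tk_le : Real.log ((c.t * c.k : ℕ) : ℝ) ≤ c.Gm := by
  obtain ⟨hx18, -, hB, hx0⟩ := c.x_facts
  have hk := c.k_geR; have hk0 := c.k_pos; have hη := c.η_pos; have hlogk := c.logk_pos
  -- `Gm = (10.5/16) (4 log k/η) (kαx)` and `4 log k/η ≥ 8k log k`, `kαx ≥ ...`; cruder: `Gm ≥ 10.5·log k·(10.5...)`
  have hα0 := c.α_pos
  have hGm : c.Gm = 10.5 / 16 * (4 * Real.log c.k / c.η) * (c.k * c.α * c.x) := by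
    rw [hB]; unfold Gm x A; field_simp; ring
  have h1 : 8 * c.k * Real.log c.k ≤ 4 * Real.log c.k / c.η := by
    rw [le_div_iff₀ hη]; have := c.hη2; rw [le_div_iff₀ (by positivity)] at this; nlinarith
  have h2 : 18 * (53 / 54) ≤ c.k * c.α * c.x := by
    have hαge := c.α_ge
    have hkx : 18 ≤ c.k * c.x := by rw [div_le_iff₀ hk0] at hx18; linarith
    calc 18 * (53 / 54 : ℝ) ≤ (c.k * c.x) * c.α := mul_le_mul hkx hαge (by norm_num) (by positivity)
      _ = _ := by ring
  have h3 : Real.log ((c.t * c.k : ℕ) : ℝ) ≤ 2 * Real.log c.k := by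
    have ht : (c.t : ℝ) ≤ c.k := by rw [c.tR]; linarith [c.h_geR]
    have htk : ((c.t * c.k : ℕ) : ℝ) ≤ (c.k : ℝ) ^ 2 := by push_cast; nlinarith
    have h0 : (0 : ℝ) < ((c.t * c.k : ℕ) : ℝ) := by have := c.t_posR; push_cast; positivity
    calc Real.log ((c.t * c.k : ℕ) : ℝ) ≤ Real.log ((c.k : ℝ) ^ 2) := Real.log_le_log h0 htk
      _ = 2 * Real.log c.k := by rw [Real.log_pow]; push_cast; ring
  rw [hGm]
  have h4 : 10.5 / 16 * (4 * Real.log c.k / c.η) * (c.k * c.α * c.x) ≥ 10.5 / 16 * (8 * c.k * Real.log c.k) * (18 * (53 / 54)) :=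
    mul_le_mul (mul_le_mul_of_nonneg_left h1 (by norm_num)) h2 (by norm_num) (by positivity)
  nlinarith

/-- **The `E_j` of Lemma 4.2 are at most `10.5 log²k/(Dkη²)`** (Lemma 4.3 with `x₀ = 18/k`).
[cite: Ford2002, Lemma 4.3 and proof of Theorem 4 ("max_{j≥2} E_j ≤ (4 log k/η)(1 + 0.5866hx) ≤ … ≤ 10.5 log²k/(Dkη²)")] -/
theorem E_le {L' : ℕ} (hL1 : 1 ≤ L') (hL2 : 2 * L' ≤ c.h) {j : ℕ} (hj : 2 ≤ j) : (c.ctx L' hL1 hL2).E j ≤ c.Gm := by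
  obtain ⟨hx18, hx04, hB, hx0⟩ := c.x_facts
  have hk := c.k_geR; have hk0 := c.k_pos; have hη := c.η_pos; have hlogk := c.logk_pos
  have hh := c.h_geR; have hh0 := c.h_pos
  have hα0 := c.α_pos; have hα1 := c.α_le_one; have hαge := c.α_ge
  -- the bracket of `E_j`, with `log P ≥ A`
  have hf0 : 0 ≤ fj c.h j := fj_nonneg (h := c.h) (by linarith) j (by omega)
  have hbr : 4 * Real.log c.k / c.η * ((j : ℝ) - 1) - fj c.h j * Real.log c.P ≤ F43 c.A c.h c.x j := by
    have h1 : fj c.h j * c.A ≤ fj c.h j * Real.log c.P := mul_le_mul_of_nonneg_left c.logP_ge hf0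
    have e : F43 c.A c.h c.x j = 4 * Real.log c.k / c.η * ((j : ℝ) - 1) - fj c.h j * c.A := by
      rw [hB]; unfold F43 fj α
      rw [Real.rpow_natCast]
      have := c.h_pos; field_simp; ring
    linarith
  -- Lemma 4.3
  have h43 := ford_lemma43' (A := c.A) (h := c.h) (x := c.x) (x₀ := 18 / c.k) c.A_pos.le (by linarith)
    (by positivity) hx18 (by linarith) (j : ℝ)
  -- the numerical absorption: `A(h−1)x[k/(72h²) + 1/(2h−1) + 0.59x] ≤ Gm`
  have hnum : c.A * (c.h - 1) * c.x * (1 / (4 * (c.h : ℝ) ^ 2 * (18 / c.k)) + 1 / (2 * c.h - 1) + 0.59 * c.x) ≤ c.Gm := by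
    -- `A(h-1)x = h · (4 log k/η)` and `Gm = (10.5/16)(4 log k/η)(kαx)`
    have e1 : c.A * (c.h - 1) * c.x = c.h * (4 * Real.log c.k / c.η) := by rw [hB]; unfold α; field_simp
    have hGm : c.Gm = 10.5 / 16 * (4 * Real.log c.k / c.η) * (c.k * c.α * c.x) := by
      rw [hB]; unfold Gm x A; field_simp; ring
    have hB0 : 0 < 4 * Real.log c.k / c.η := by positivity
    have hkx : 18 ≤ c.k * c.x := by rw [div_le_iff₀ hk0] at hx18; linarith
    have a1 : (c.h : ℝ) * (1 / (4 * (c.h : ℝ) ^ 2 * (18 / c.k))) = c.k / (72 * c.h) := by field_simp; ring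
    have a2 : c.k / (72 * (c.h : ℝ)) ≤ 0.01544 := by rw [div_le_iff₀ (by positivity)]; nlinarith [c.hh]
    have a3 : (c.h : ℝ) * (1 / (2 * c.h - 1)) ≤ 0.5047 := by
      rw [mul_one_div, div_le_iff₀ (by linarith)]; nlinarith
    have a4 : (c.h : ℝ) * (0.59 * c.x) ≤ 0.59 * (c.k * c.x) := by nlinarith [c.h_le_k, hx0]
    have key : (c.h : ℝ) * (1 / (4 * (c.h : ℝ) ^ 2 * (18 / c.k)) + 1 / (2 * c.h - 1) + 0.59 * c.x)
        ≤ 10.5 / 16 * (c.k * c.α * c.x) := by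
      have hkx0 : 0 ≤ c.k * c.x := by positivity
      have a5 : 0.644 * (c.k * c.x) ≤ 10.5 / 16 * (c.k * c.α * c.x) := by
        have c1 : (0.644 : ℝ) ≤ 10.5 / 16 * (53 / 54) := by norm_num
        have c2 : (10.5 : ℝ) / 16 * (53 / 54) ≤ 10.5 / 16 * c.α := by linarith
        calc 0.644 * (c.k * c.x) ≤ (10.5 / 16 * (53 / 54)) * (c.k * c.x) := mul_le_mul_of_nonneg_right c1 hkx0
          _ ≤ (10.5 / 16 * c.α) * (c.k * c.x) := mul_le_mul_of_nonneg_right c2 hkx0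
          _ = _ := by ring
      calc (c.h : ℝ) * (1 / (4 * (c.h : ℝ) ^ 2 * (18 / c.k)) + 1 / (2 * c.h - 1) + 0.59 * c.x)
          = c.h * (1 / (4 * (c.h : ℝ) ^ 2 * (18 / c.k))) + c.h * (1 / (2 * c.h - 1)) + c.h * (0.59 * c.x) := by ring
        _ ≤ 0.01544 + 0.5047 + 0.59 * (c.k * c.x) := by rw [a1]; linarith
        _ ≤ 10.5 / 16 * (c.k * c.α * c.x) := by linarith
    calc c.A * (c.h - 1) * c.x * (1 / (4 * (c.h : ℝ) ^ 2 * (18 / c.k)) + 1 / (2 * c.h - 1) + 0.59 * c.x)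
        = (4 * Real.log c.k / c.η) * ((c.h : ℝ) * (1 / (4 * (c.h : ℝ) ^ 2 * (18 / c.k)) + 1 / (2 * c.h - 1) + 0.59 * c.x)) := by
          rw [e1]; ring
      _ ≤ (4 * Real.log c.k / c.η) * (10.5 / 16 * (c.k * c.α * c.x)) := mul_le_mul_of_nonneg_left key hB0.le
      _ = c.Gm := by rw [hGm]; ring
  -- assemble: `E_j = α^{L'−j} · bracket ≤ max(bracket,0) ≤ Gm`
  have hGm0 : 0 ≤ c.Gm := by unfold Gm; have := c.D_pos; positivity
  show (c.ctx L' hL1 hL2).α ^ ((c.ctx L' hL1 hL2).L - j) *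
      (4 * Real.log (c.ctx L' hL1 hL2).k / (c.ctx L' hL1 hL2).η * ((j : ℝ) - 1)
        - fj (c.ctx L' hL1 hL2).h j * Real.log (c.ctx L' hL1 hL2).P) ≤ c.Gm
  have hbr' : 4 * Real.log c.k / c.η * ((j : ℝ) - 1) - fj c.h j * Real.log c.P ≤ c.Gm := hbr.trans (h43.trans hnum)
  have hαp : 0 ≤ c.α ^ (L' - j) := pow_nonneg hα0.le _
  have hαp1 : c.α ^ (L' - j) ≤ 1 := pow_le_one₀ hα0.le hα1
  change c.α ^ (L' - j) * (4 * Real.log c.k / c.η * ((j : ℝ) - 1) - fj c.h j * Real.log c.P) ≤ c.Gm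
  rcases le_or_gt 0 (4 * Real.log c.k / c.η * ((j : ℝ) - 1) - fj c.h j * Real.log c.P) with hpos | hneg
  · calc c.α ^ (L' - j) * _ ≤ 1 * (4 * Real.log c.k / c.η * ((j : ℝ) - 1) - fj c.h j * Real.log c.P) :=
        mul_le_mul_of_nonneg_right hαp1 hpos
      _ ≤ c.Gm := by rw [one_mul]; exact hbr'
  · have : c.α ^ (L' - j) * (4 * Real.log c.k / c.η * ((j : ℝ) - 1) - fj c.h j * Real.log c.P) ≤ 0 :=
      mul_nonpos_of_nonneg_of_nonpos hαp hneg.le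
    linarith

/-- `C_j ≤ e^{t·Gm}` for every `j ≥ 1`. [cite: Ford2002, proof of Theorem 4 ("log C_L = 10.5 t log²k/(Dkη²) − …")] -/
theorem Cseq_le {L' : ℕ} (hL1 : 1 ≤ L') (hL2 : 2 * L' ≤ c.h) :
    ∀ j : ℕ, 1 ≤ j → (c.ctx L' hL1 hL2).Cseq j ≤ Real.exp (c.t * c.Gm) := by
  have h1 : (c.ctx L' hL1 hL2).Cseq 1 ≤ Real.exp (c.t * c.Gm) := by
    rw [L42Ctx.Cseq_one]
    show ((c.t * c.k : ℕ) : ℝ) ^ c.t ≤ Real.exp (c.t * c.Gm)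
    have h0 : (0 : ℝ) < ((c.t * c.k : ℕ) : ℝ) := by have := c.t_posR; have := c.k_pos; push_cast; positivity
    rw [← Real.exp_log (pow_pos h0 _), Real.exp_le_exp, Real.log_pow]
    exact mul_le_mul_of_nonneg_left c.log_tk_le c.t_posR.le
  intro j hj
  induction j, hj using Nat.le_induction with
  | base => exact h1
  | succ j hj ih =>
    obtain ⟨i, rfl⟩ : ∃ i, j = i + 1 := ⟨j - 1, by omega⟩
    rw [show i + 1 + 1 = i + 2 by ring, L42Ctx.Cseq_succ_succ]
    exact max_le ih (Real.exp_le_exp.2 (mul_le_mul_of_nonneg_left (c.E_le hL1 hL2 (by omega)) c.t_posR.le))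


/-! #### Assembly -/

/-- Auxiliary step (elementary consequence of the definitions and the standing hypotheses). [folklore] -/
theorem log12η_nonpos : Real.log (12 * c.η) ≤ 0 := by
  refine Real.log_nonpos (by have := c.η_pos; positivity) ?_
  have h2k : (1 : ℝ) / (2 * c.k) ≤ 1 / 120 := by
    rw [div_le_div_iff₀ (by have := c.k_pos; positivity) (by norm_num)]; linarith [c.k_geR]
  have := c.hη2.trans h2k; linarith

/-- `g = (1/η+h)α^{s/t} − h ≤ (1/η+h)α^{L'−1} − h` for `L' − 1 ≤ s/t` (`α ≤ 1`). [cite: Ford2002, proof of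
Theorem 4 ("For the constants, we use α^{L−1} > α^L ≥ α^{s/t}")] -/
theorem g_le {L' : ℕ} (hL1 : 1 ≤ L') (hL' : ((L' : ℝ) - 1) ≤ (c.s : ℝ) / c.t) :
    c.g ≤ (1 / c.η + c.h) * c.α ^ (L' - 1) - c.h := by
  unfold g
  have h1 : c.α ^ ((c.s : ℝ) / c.t) ≤ c.α ^ (L' - 1) := by
    rw [← Real.rpow_natCast]
    refine Real.rpow_le_rpow_of_exponent_ge c.α_pos c.α_le_one ?_
    rw [Nat.cast_sub hL1]; push_cast; exact hL'
  have h2 : 0 ≤ 1 / c.η + c.h := by have := c.η_pos; have := c.h_pos; positivity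
  nlinarith

/-- **The logarithmic bound for `J_{L't}`** with all constants estimated:
`log J_{L't} ≤ tL'·g·log(12η) + t·Gm + tC(L',2)(2 + log R) + X_{L'} log P`. [cite: Ford2002, proof of
Theorem 4 ("Therefore, by Lemma 4.2, J_{Lt,k,h} ≤ C_L (e²R)^{…} P^{…}, where log C_L = …")] -/
theorem logJ_le' {L' : ℕ} (hL1 : 1 ≤ L') (hL2 : 2 * L' ≤ c.h) (hL' : ((L' : ℝ) - 1) ≤ (c.s : ℝ) / c.t) :
    Real.log (Jinc c.k (c.t * L') ((smoothSet c.P c.R).map Nat.castEmbedding) c.h c.k : ℝ)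
      ≤ ((c.t * L' : ℝ) * c.g) * Real.log (12 * c.η) + c.t * c.Gm
        + (c.t * L'.choose 2 : ℕ) * (2 + Real.log c.R)
        + ((c.t : ℝ) * (2 * L' - c.h * (1 - c.α ^ L'))) * Real.log c.P := by
  have h1 := c.logJ_le hL1 hL2
  have h2 : ((c.t * L' : ℝ) * ((1 / c.η + c.h) * c.α ^ (L' - 1) - c.h)) * Real.log (12 * c.η)
      ≤ ((c.t * L' : ℝ) * c.g) * Real.log (12 * c.η) := by
    refine mul_le_mul_of_nonpos_right ?_ c.log12η_nonpos
    exact mul_le_mul_of_nonneg_left (c.g_le hL1 hL') (by have := c.t_posR; positivity)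
  have h3 : Real.log ((c.ctx L' hL1 hL2).Cseq L') ≤ c.t * c.Gm := by
    have := c.Cseq_le hL1 hL2 L' hL1
    have h0 := (c.ctx L' hL1 hL2).Cseq_pos L'
    calc Real.log ((c.ctx L' hL1 hL2).Cseq L') ≤ Real.log (Real.exp (c.t * c.Gm)) := Real.log_le_log h0 this
      _ = c.t * c.Gm := Real.log_exp _
  linarith

/-- The `R`-part: `t·C(L,2) ≤ s²/(2t)` when `tL ≤ s`, and more generally
`t·C(L,2) + uL ≤ s²/(2t)` for `s = Lt + u`, `0 ≤ u ≤ t`. [cite: Ford2002, proof of Theorem 4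
("(e²R)^{(t/2)L² + L(u − t/2)} < (e²R)^{s²/(2t)}")] -/
theorem Rpart_le {t L u s : ℝ} (ht : 0 < t) (hL : 0 ≤ L) (hu0 : 0 ≤ u) (hut : u ≤ t) (hs : s = L * t + u) :
    t * (L * (L - 1) / 2) + u * L ≤ s ^ 2 / (2 * t) := by
  rw [hs, le_div_iff₀ (by positivity)]
  nlinarith [mul_nonneg hL hu0, mul_nonneg hL (sub_nonneg.2 hut), sq_nonneg u]

/-- The `P`-part: `α^L (1 − u/(ht)) ≤ e^{−s/(ht)}` for `s = Lt + u`. [cite: Ford2002, proof of Theorem 4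
("(1−u/t)Δ_L + (u/t)Δ_{L+1} = t(t−1)/2 + htα^L(1 − u/(ht)) < t(t−1)/2 + ht e^{−s/(ht)}")] -/
theorem Ppart_le {h t u s : ℝ} {L : ℕ} (hh : 1 ≤ h) (ht : 0 < t) (hut : u ≤ h * t)
    (hs : s = L * t + u) :
    (1 - 1 / h) ^ L * (1 - u / (h * t)) ≤ Real.exp (-s / (h * t)) := by
  have h1 := alpha_pow_le_exp hh L
  have h2 : 1 - u / (h * t) ≤ Real.exp (-(u / (h * t))) := by
    have := Real.add_one_le_exp (-(u / (h * t))); linarith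
  have h3 : 0 ≤ 1 - u / (h * t) := by rw [sub_nonneg, div_le_one (by positivity)]; exact hut
  have h0 : 0 ≤ (1 - 1 / h) ^ L := by
    apply pow_nonneg; have : 1 / h ≤ 1 := by rw [div_le_one (by linarith)]; exact hh
    linarith
  calc (1 - 1 / h) ^ L * (1 - u / (h * t)) ≤ Real.exp (-(L : ℝ) / h) * Real.exp (-(u / (h * t))) :=
        mul_le_mul h1 h2 h3 (Real.exp_pos _).le
    _ = Real.exp (-s / (h * t)) := by
        rw [← Real.exp_add]; congr 1; rw [hs]; field_simp; ring

/-- **Theorem 4 for the context** (logarithmic form). [cite: Ford2002, proof of Theorem 4 ((4.19) and the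
two displays after it)] -/
theorem main_log :
    Real.log (Jinc c.k c.s ((smoothSet c.P c.R).map Nat.castEmbedding) c.h c.k : ℝ)
      ≤ ((c.s : ℝ) ^ 2 / c.t + c.t * c.Gm - c.s * c.g * Real.log (1 / (12 * c.η)))
        + ((2 * c.s : ℝ) - c.t * c.h + c.η * (c.s : ℝ) ^ 2 / (2 * c.t)
            + c.h * c.t * Real.exp (-(c.s : ℝ) / (c.h * c.t))) * Real.log c.P := by
  have ht := c.t_posR; have hη := c.η_pos; have hlogP := c.logP_pos; have hh := c.h_geR; have hh0 := c.h_pos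
  have hL2 := c.L_ge
  have hLR : (2 : ℝ) ≤ c.L := by exact_mod_cast hL2
  have hsR := c.sR
  have huR : (c.u : ℝ) < c.t := by exact_mod_cast c.u_lt
  have hu0 : (0 : ℝ) ≤ c.u := Nat.cast_nonneg _
  have hlog12 := c.log12η_nonpos
  have hlog1 : Real.log (1 / (12 * c.η)) = -Real.log (12 * c.η) := by rw [one_div, Real.log_inv]
  have hlogR0 : 0 ≤ 2 + Real.log c.R := by linarith [c.logR_ge]
  have hlogR : Real.log c.R = c.η * Real.log c.P := c.logR_eq
  have hlink : (c.s : ℝ) ^ 2 / (2 * c.t) * Real.log c.R = c.η * (c.s : ℝ) ^ 2 / (2 * c.t) * Real.log c.P := by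
    rw [hlogR]; ring
  set B : Finset ℤ := (smoothSet c.P c.R).map Nat.castEmbedding with hB
  -- the bound at level `L`
  have hLs : ((c.L : ℝ) - 1) ≤ (c.s : ℝ) / c.t := by linarith [c.L_le_sdivt]
  have hJL := c.logJ_le' (L' := c.L) (by omega) c.two_L_le hLs
  have hchooseL : ((c.t * (c.L).choose 2 : ℕ) : ℝ) = c.t * ((c.L : ℝ) * (c.L - 1) / 2) := by
    rw [Nat.cast_mul, Nat.cast_choose_two]
  rcases Nat.eq_zero_or_pos c.u with hu | hu
  · -- ### `u = 0`: `s = Lt`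
    have hs : c.t * c.L = c.s := by rw [c.s_eq, hu, add_zero, mul_comm]
    have hsR' : (c.s : ℝ) = c.L * c.t := by rw [hsR, hu]; push_cast; ring
    rw [hs] at hJL
    refine hJL.trans ?_
    -- the four comparisons
    have a1 : ((c.t * c.L : ℝ) * c.g) * Real.log (12 * c.η) = -(c.s * c.g * Real.log (1 / (12 * c.η))) := by
      rw [hlog1, hsR']; ring
    have a2 : ((c.t * (c.L).choose 2 : ℕ) : ℝ) * (2 + Real.log c.R) ≤ ((c.s : ℝ) ^ 2 / (2 * c.t)) * (2 + Real.log c.R) := by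
      refine mul_le_mul_of_nonneg_right ?_ hlogR0
      rw [hchooseL]
      have := Rpart_le (t := (c.t : ℝ)) (L := c.L) (u := 0) (s := c.s) ht (by linarith) le_rfl ht.le (by rw [hsR']; ring)
      linarith
    have a3 : ((c.t : ℝ) * (2 * c.L - c.h * (1 - c.α ^ c.L))) * Real.log c.P
        ≤ ((2 * c.s : ℝ) - c.t * c.h + c.h * c.t * Real.exp (-(c.s : ℝ) / (c.h * c.t))) * Real.log c.P := by
      refine mul_le_mul_of_nonneg_right ?_ hlogP.le
      have hP := Ppart_le (h := (c.h : ℝ)) (t := (c.t : ℝ)) (u := 0) (s := c.s) (L := c.L) (by linarith) ht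
        (by positivity) (by rw [hsR']; ring)
      rw [zero_div, sub_zero, mul_one] at hP
      unfold α
      have := mul_le_mul_of_nonneg_left hP (by positivity : (0 : ℝ) ≤ c.h * c.t)
      nlinarith
    calc ((c.t * c.L : ℝ) * c.g) * Real.log (12 * c.η) + c.t * c.Gm
          + ((c.t * (c.L).choose 2 : ℕ) : ℝ) * (2 + Real.log c.R)
          + ((c.t : ℝ) * (2 * c.L - c.h * (1 - c.α ^ c.L))) * Real.log c.P
        ≤ -(c.s * c.g * Real.log (1 / (12 * c.η))) + c.t * c.Gm
          + ((c.s : ℝ) ^ 2 / (2 * c.t)) * (2 + Real.log c.R)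
          + ((2 * c.s : ℝ) - c.t * c.h + c.h * c.t * Real.exp (-(c.s : ℝ) / (c.h * c.t))) * Real.log c.P := by
          rw [a1]; linarith [a2, a3]
      _ = _ := by rw [hlogR]; ring
  · -- ### `u ≥ 1`: Hölder between `L` and `L + 1`
    have hu' : c.u ≠ 0 := by omega
    have hL12 := c.two_L1_le hu'
    have hLs1 : (((c.L + 1 : ℕ) : ℝ) - 1) ≤ (c.s : ℝ) / c.t := by push_cast; linarith [c.L_le_sdivt]
    have hJL1 := c.logJ_le' (L' := c.L + 1) (by omega) hL12 hLs1
    -- Hölder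
    set θ : ℝ := 1 - (c.u : ℝ) / c.t with hθ
    have hθ0 : 0 < θ := by rw [hθ, sub_pos, div_lt_one ht]; exact huR
    have hθ1 : θ < 1 := by
      rw [hθ]; have : (0 : ℝ) < c.u := by exact_mod_cast hu
      have : 0 < (c.u : ℝ) / c.t := by positivity
      linarith
    have hθt : (1 - θ) * c.t = c.u := by rw [hθ]; field_simp; ring
    set F : (Fin c.k → ℝ) → ℝ := fun α => ‖tp B (nuR c.k c.h c.k) α‖ with hF
    have hFc : Continuous F := (continuous_tp _ _).norm
    have hF0 : ∀ α, 0 ≤ F α := fun α => norm_nonneg _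
    have hab : θ * ((2 * (c.t * c.L) : ℕ) : ℝ) + (1 - θ) * ((2 * (c.t * (c.L + 1)) : ℕ) : ℝ) = ((2 * c.s : ℕ) : ℝ) := by
      push_cast; rw [hsR]; linear_combination (2 : ℝ) * hθt
    have hHo := integral_rpow_interpolate_le (n := c.k) hFc hF0 (a := ((2 * (c.t * c.L) : ℕ) : ℝ))
      (b := ((2 * (c.t * (c.L + 1)) : ℕ) : ℝ)) (θ := θ) (Nat.cast_nonneg _) (Nat.cast_nonneg _) hθ0 hθ1
    rw [hab] at hHo
    simp only [hF, Real.rpow_natCast, integral_norm_tp_nuR_pow] at hHo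
    -- `hHo : J_s ≤ J_{tL}^θ J_{t(L+1)}^{1-θ}`
    have hJ1 := c.one_le_Jinc (c.t * c.L)
    have hJ2 := c.one_le_Jinc (c.t * (c.L + 1))
    have hJs := c.one_le_Jinc c.s
    have hlogHo : Real.log (Jinc c.k c.s B c.h c.k : ℝ)
        ≤ θ * Real.log (Jinc c.k (c.t * c.L) B c.h c.k : ℝ) + (1 - θ) * Real.log (Jinc c.k (c.t * (c.L + 1)) B c.h c.k : ℝ) := by
      have h1 := Real.log_le_log (by rw [hB]; linarith) hHo
      rw [Real.log_mul (Real.rpow_pos_of_pos (by rw [hB]; linarith) _).ne' (Real.rpow_pos_of_pos (by rw [hB]; linarith) _).ne',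
        Real.log_rpow (by rw [hB]; linarith), Real.log_rpow (by rw [hB]; linarith)] at h1
      exact h1
    rw [hB] at hlogHo
    refine hlogHo.trans ?_
    have hθ0' := hθ0.le
    have hθ1' : 0 ≤ 1 - θ := by linarith
    have hcomb := add_le_add (mul_le_mul_of_nonneg_left hJL hθ0') (mul_le_mul_of_nonneg_left hJL1 hθ1')
    refine hcomb.trans ?_
    -- the four comparisons
    have hchooseL1 : ((c.t * (c.L + 1).choose 2 : ℕ) : ℝ) = c.t * ((c.L : ℝ) * (c.L - 1) / 2) + c.t * c.L := by
      rw [Nat.cast_mul, Nat.choose_succ_succ', Nat.choose_one_right, Nat.cast_add, Nat.cast_choose_two]; ring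
    have a1 : θ * (((c.t * c.L : ℝ) * c.g) * Real.log (12 * c.η)) + (1 - θ) * (((c.t * ((c.L + 1 : ℕ) : ℝ)) * c.g) * Real.log (12 * c.η))
        = -(c.s * c.g * Real.log (1 / (12 * c.η))) := by
      rw [hlog1, hsR]; push_cast; linear_combination (c.g * Real.log (12 * c.η)) * hθt
    have a2 : θ * (((c.t * (c.L).choose 2 : ℕ) : ℝ) * (2 + Real.log c.R)) + (1 - θ) * (((c.t * (c.L + 1).choose 2 : ℕ) : ℝ) * (2 + Real.log c.R))
        ≤ ((c.s : ℝ) ^ 2 / (2 * c.t)) * (2 + Real.log c.R) := by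
      rw [hchooseL, hchooseL1]
      have hR := Rpart_le (t := (c.t : ℝ)) (L := c.L) (u := c.u) (s := c.s) ht (by linarith) hu0 huR.le hsR
      have e : θ * (c.t * ((c.L : ℝ) * (c.L - 1) / 2) * (2 + Real.log c.R))
          + (1 - θ) * ((c.t * ((c.L : ℝ) * (c.L - 1) / 2) + c.t * c.L) * (2 + Real.log c.R))
          = (c.t * ((c.L : ℝ) * (c.L - 1) / 2) + ((1 - θ) * c.t) * c.L) * (2 + Real.log c.R) := by ring
      rw [e, hθt]
      exact mul_le_mul_of_nonneg_right hR hlogR0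
    have a3 : θ * (((c.t : ℝ) * (2 * c.L - c.h * (1 - c.α ^ c.L))) * Real.log c.P)
        + (1 - θ) * (((c.t : ℝ) * (2 * ((c.L + 1 : ℕ) : ℝ) - c.h * (1 - c.α ^ (c.L + 1)))) * Real.log c.P)
        ≤ ((2 * c.s : ℝ) - c.t * c.h + c.h * c.t * Real.exp (-(c.s : ℝ) / (c.h * c.t))) * Real.log c.P := by
      have hut : (c.u : ℝ) ≤ c.h * c.t := huR.le.trans (le_mul_of_one_le_left ht.le (by linarith))
      have hP := Ppart_le (h := (c.h : ℝ)) (t := (c.t : ℝ)) (u := c.u) (s := c.s) (L := c.L) (by linarith) ht hut hsR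
      -- the combination equals `(2s − th + thα^L(1 − u/(ht))) log P`
      have e : θ * (((c.t : ℝ) * (2 * c.L - c.h * (1 - c.α ^ c.L))) * Real.log c.P)
          + (1 - θ) * (((c.t : ℝ) * (2 * ((c.L + 1 : ℕ) : ℝ) - c.h * (1 - c.α ^ (c.L + 1)))) * Real.log c.P)
          = ((2 * c.s : ℝ) - c.t * c.h + c.h * c.t * (c.α ^ c.L * (1 - c.u / (c.h * c.t)))) * Real.log c.P := by
        rw [hsR, pow_succ]; push_cast
        have hα : c.α = 1 - 1 / (c.h : ℝ) := rfl
        rw [hθ, hα]; field_simp; ring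
      rw [e]
      refine mul_le_mul_of_nonneg_right ?_ hlogP.le
      unfold α at hP ⊢
      have := mul_le_mul_of_nonneg_left hP (by positivity : (0 : ℝ) ≤ c.h * c.t)
      linarith
    calc θ * (((c.t * c.L : ℝ) * c.g) * Real.log (12 * c.η) + c.t * c.Gm
            + ((c.t * (c.L).choose 2 : ℕ) : ℝ) * (2 + Real.log c.R)
            + ((c.t : ℝ) * (2 * c.L - c.h * (1 - c.α ^ c.L))) * Real.log c.P)
          + (1 - θ) * (((c.t * ((c.L + 1 : ℕ) : ℝ)) * c.g) * Real.log (12 * c.η) + c.t * c.Gm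
            + ((c.t * (c.L + 1).choose 2 : ℕ) : ℝ) * (2 + Real.log c.R)
            + ((c.t : ℝ) * (2 * ((c.L + 1 : ℕ) : ℝ) - c.h * (1 - c.α ^ (c.L + 1)))) * Real.log c.P)
        = (θ * (((c.t * c.L : ℝ) * c.g) * Real.log (12 * c.η)) + (1 - θ) * (((c.t * ((c.L + 1 : ℕ) : ℝ)) * c.g) * Real.log (12 * c.η)))
          + c.t * c.Gm
          + (θ * (((c.t * (c.L).choose 2 : ℕ) : ℝ) * (2 + Real.log c.R)) + (1 - θ) * (((c.t * (c.L + 1).choose 2 : ℕ) : ℝ) * (2 + Real.log c.R)))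
          + (θ * (((c.t : ℝ) * (2 * c.L - c.h * (1 - c.α ^ c.L))) * Real.log c.P)
            + (1 - θ) * (((c.t : ℝ) * (2 * ((c.L + 1 : ℕ) : ℝ) - c.h * (1 - c.α ^ (c.L + 1)))) * Real.log c.P)) := by ring
      _ ≤ -(c.s * c.g * Real.log (1 / (12 * c.η))) + c.t * c.Gm
          + ((c.s : ℝ) ^ 2 / (2 * c.t)) * (2 + Real.log c.R)
          + ((2 * c.s : ℝ) - c.t * c.h + c.h * c.t * Real.exp (-(c.s : ℝ) / (c.h * c.t))) * Real.log c.P := by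
          rw [a1]; linarith [a2, a3]
      _ = _ := by rw [hlogR]; ring

/-- **Theorem 4 for the context.** [cite: Ford2002, Theorem 4] -/
theorem main :
    (Jinc c.k c.s ((smoothSet c.P c.R).map Nat.castEmbedding) c.h c.k : ℝ)
      ≤ Real.exp ((c.s : ℝ) ^ 2 / c.t + c.t * c.Gm - c.s * c.g * Real.log (1 / (12 * c.η)))
        * c.P ^ ((2 * c.s : ℝ) - c.t * c.h + c.η * (c.s : ℝ) ^ 2 / (2 * c.t)
            + c.h * c.t * Real.exp (-(c.s : ℝ) / (c.h * c.t))) := by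
  have h := c.main_log
  have hJ := c.one_le_Jinc c.s
  rw [← Real.exp_log (by linarith : (0 : ℝ) < (Jinc c.k c.s ((smoothSet c.P c.R).map Nat.castEmbedding) c.h c.k : ℝ)),
    Real.rpow_def_of_pos c.P_pos, ← Real.exp_add, Real.exp_le_exp]
  linarith

end T4Ctx

/-- **Ford's Theorem 4, library constants.** Let `k ≥ 60`, `0.9k ≤ h ≤ k − 2`, `t = k − h + 1`,
`2t ≤ s ≤ ⌊h/2⌋ t`, `D ≥ 10`, `P ≥ e^{Dk²}`, `2/k³ < η ≤ 1/(2k)`, `18/k ≤ 4 log k/(Dk²η) ≤ 0.4`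
((1.10)), and `η log P ≥ 80`. Then
`J_{s,k,h}(𝒞(P,P^η)) ≤ e^C P^{2s − (t/2)(h+k) + t(t−1)/2 + ηs²/(2t) + ht e^{−s/(ht)}}` with
`C = s²/t + 10.5 t log²k/(Dkη²) − s((1/η+h)(1−1/h)^{s/t} − h) log(1/(12η))` — the printed Theorem 4
with `12η` in place of `10η` inside the logarithm (from the prime inputs of this library) and the
extra hypothesis `η log P ≥ 80` (for (4.11) via `FordVK.card_calC_ge`). [cite: Ford2002, Theorem 4] -/
theorem ford_theorem4_lib (k h s : ℕ) (P η D : ℝ) (hk : 60 ≤ k) (hh : (0.9 : ℝ) * k ≤ h) (hhk : h + 2 ≤ k)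
    (hs1 : 2 * (k - h + 1) ≤ s) (hs2 : s ≤ (h / 2) * (k - h + 1)) (hD : 10 ≤ D)
    (hP : Real.exp (D * (k : ℝ) ^ 2) ≤ P) (hη1 : 2 / (k : ℝ) ^ 3 < η) (hη2 : η ≤ 1 / (2 * (k : ℝ)))
    (h110a : 18 / (k : ℝ) ≤ 4 * Real.log k / (D * (k : ℝ) ^ 2 * η))
    (h110b : 4 * Real.log k / (D * (k : ℝ) ^ 2 * η) ≤ 0.4) (hR80 : 80 ≤ η * Real.log P) :
    (Jinc k s ((calC P (P ^ η)).map Nat.castEmbedding) h k : ℝ)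
      ≤ Real.exp ((s : ℝ) ^ 2 / ((k : ℝ) - h + 1)
          + 10.5 * ((k : ℝ) - h + 1) * Real.log k ^ 2 / (D * k * η ^ 2)
          - s * ((1 / η + h) * (1 - 1 / (h : ℝ)) ^ ((s : ℝ) / ((k : ℝ) - h + 1)) - h)
            * Real.log (1 / (12 * η)))
        * P ^ ((2 * s : ℝ) - ((k : ℝ) - h + 1) / 2 * (h + k) + ((k : ℝ) - h + 1) * ((k : ℝ) - h) / 2
          + η * (s : ℝ) ^ 2 / (2 * ((k : ℝ) - h + 1))
          + h * ((k : ℝ) - h + 1) * Real.exp (-(s : ℝ) / (h * ((k : ℝ) - h + 1)))) := by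
  let c : T4Ctx := ⟨k, h, s, P, η, D, hk, hh, hhk, hs1, hs2, hD, hP, hη1, hη2, h110a, h110b, hR80⟩
  have hm := c.main
  have ht : (c.t : ℝ) = (k : ℝ) - h + 1 := c.tR
  rw [calC_eq_smoothSet]
  have e1 : (s : ℝ) ^ 2 / ((k : ℝ) - h + 1) + 10.5 * ((k : ℝ) - h + 1) * Real.log k ^ 2 / (D * k * η ^ 2)
      - s * ((1 / η + h) * (1 - 1 / (h : ℝ)) ^ ((s : ℝ) / ((k : ℝ) - h + 1)) - h) * Real.log (1 / (12 * η))
      = (c.s : ℝ) ^ 2 / c.t + c.t * c.Gm - c.s * c.g * Real.log (1 / (12 * c.η)) := by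
    rw [ht]; unfold T4Ctx.Gm T4Ctx.g T4Ctx.α; rw [ht]; ring
  have e2 : (2 * s : ℝ) - ((k : ℝ) - h + 1) / 2 * (h + k) + ((k : ℝ) - h + 1) * ((k : ℝ) - h) / 2
        + η * (s : ℝ) ^ 2 / (2 * ((k : ℝ) - h + 1)) + h * ((k : ℝ) - h + 1) * Real.exp (-(s : ℝ) / (h * ((k : ℝ) - h + 1)))
      = (2 * c.s : ℝ) - c.t * c.h + c.η * (c.s : ℝ) ^ 2 / (2 * c.t) + c.h * c.t * Real.exp (-(c.s : ℝ) / (c.h * c.t)) := by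
    rw [ht]; ring
  rw [e1, e2]
  exact hm

end FordVK
end Literature.NumberTheory.LFunctions
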